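import Literature.NumberTheory.LFunctions.EnergyThirdMoment
import Literature.NumberTheory.LFunctions.DoubleZetaSumsHeathBrown
import Literature.NumberTheory.LFunctions.SeparatedPointSums
import HarnessLib

/-!
# The discrete moments of `R` from Heath-Brown's theorem (Guth–Maynard Lemmas 11.5 and 11.6)

Topic `NumberTheory/LFunctions`, family RH. Part of the programme around the tree's named fact
`Literature.NumberTheory.LFunctions.zeroDensity_guth_maynard`, reduced by `LargeValuesAssembly.lean` to
Propositions 6.1, 10.1, 11.1 of L. Guth, J. Maynard, *New large value estimates for Dirichlet
polynomials*, Ann. of Math. 203 (2026). The proof of Proposition 11.1 ("Bound for energy") uses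
Heath-Brown's large values theorem [D. R. Heath-Brown, *A large values estimate for Dirichlet
polynomials*, J. London Math. Soc. 20 (1979); Theorem "Heath-Brown" of §6 of the paper] only through
Lemmas 11.5 and 11.6. Heath-Brown's theorem is PROVED in the tree
(`HeathBrownDZS.heathBrown_differenceSet`, `DoubleZetaSumsHeathBrown.lean`, the paper's Theorem 1.6);
this file PROVES both lemmas unconditionally (`discrete_second_moment`, `discrete_fourth_moment`, §5),
via versions `…_of_HB` taking Heath-Brown's estimate as an explicit hypothesis `hHB` (in the form: for
every `ε > 0` there is `C` with
`∑_{t₁,t₂∈𝒯} |∑_{N≤n≤2N} a_n n^{i(t₁−t₂)}|² ≤ C T^ε (|𝒯|²N + |𝒯|N² + |𝒯|^{5/4}T^{1/2}N)` for all `N, T ≥ 1`,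
`1`-bounded `a_n` and finite `1`-separated `𝒯` in an interval of length `T`) and the bridge
`hHB_of_heathBrown_differenceSet` (range `(N,2N] → [N,2N]`, `T ≥ T₀(ε) → T ≥ 1`). No named fact is
introduced.

* `discrete_second_moment[_of_HB]` — **Lemma 11.5**:
  `∑_{n₁,n₂∈[M,2M]} |R(n₁/n₂)|² ≤ C T^ε (|W|²M + |W|M² + |W|^{5/4}T^{1/2}M)` (via the identity
  `sum_normSq_Rfun_eq`, `= ∑_{t₁,t₂}|∑_n n^{i(t₁−t₂)}|²`, from `DoubleZetaSumMajorant.lean`);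
* `discrete_fourth_moment[_of_HB]` — **Lemma 11.6**:
  `∑_{n₁,n₂∈[M,2M]} |R(n₁/n₂)|⁴ ≤ C T^ε (|W|⁴M + M²E(W) + E(W)^{3/4}|W|T^{1/2}M)` (the `_of_HB` version
  carries the factor `L²`, `L` the number of dyadic classes; `card_classes_le`: `L ≤ log₂|W|² + 1`, and
  `classes_sq_le_rpow`: `L² ≪_δ T^δ`, absorb it), following the paper: `|R|⁴ = |∑_{(t₁,t₂)∈W²} x^{i(t₁−t₂)}|²`
  (`normSq_Rfun_eq_sum_pairs`), the pairs grouped by `u = ⌊t₁−t₂⌋` into dyadic classes of the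
  multiplicity `c(u)` (`uu`, `cnt`, `cls`, `clsPairs`), Cauchy–Schwarz over the classes
  (`norm_Rfun_pow_four_le`), `∑_{n₁,n₂}|Y|² = ∑_{q,q'}|D(θ_q−θ_{q'})|²` (`sum_normSq_Y_eq`), Lemma 11.3
  to replace the fractional shift by an integral (`normSq_D_shift_le`, from `EnergyThirdMoment.lean`),
  Heath-Brown on each class with `a_n = n^{it}` (`HB_fixed_shift`), and the counts `B|U_B| ≤ |W|²`
  (`card_U_le`), `B²|U_B| ≤ E(W)` (`sq_mul_card_U_le_energy`, the injection
  `(q,q') ↦ (t₁,t₂',t₂,t₁')` into the energy quadruples), `class_algebra`.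

Here `R = GuthMaynardRFunction.Rfun` and `E(W)` is the additive energy count `#{|t₁+t₂−t₃−t₄| ≤ 1}` (the
expression of `GuthMaynardAssembly.addEnergy`). Definitions (with bodies): `ePair`, `uu`, `cnt`, `cls`,
`clsPairs`. What remains of Proposition 11.1 after this file: Lemma 11.9 (Cauchy–Schwarz with Lemmas
11.5–11.6 and algebra) and the final assembly of §11; all analytic inputs (Lemmas 11.3–11.8 and
Heath-Brown's theorem) are then in the tree.

## References

* L. Guth, J. Maynard, *New large value estimates for Dirichlet polynomials*, Ann. of Math. (2)
  203 (2026), no. 2; arXiv:2405.20552 (2024): §6 (Theorem "Heath-Brown"), §11, Lemmas 11.5, 11.6 and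
  their proofs.
* D. R. Heath-Brown, *A large values estimate for Dirichlet polynomials*, J. London Math. Soc. (2) 20
  (1979), 8–18.
-/

noncomputable section

open Real Set Filter Topology Complex MeasureTheory Finset
open scoped FourierTransform ContDiff

namespace Literature.NumberTheory.LFunctions

namespace GuthMaynardDiscreteMoments

open GuthMaynardFourier GuthMaynardRFunction GuthMaynardEnergy

/-! ## §1. The discrete second moment of `R` (Guth–Maynard Lemma 11.5, from Heath-Brown's theorem) -/

/-- **`∑_{n₁,n₂∈[M,2M]} |R(n₁/n₂)|² = ∑_{t₁,t₂∈W} |∑_{n∈[M,2M]} n^{i(t₁−t₂)}|²`** (the display in the proof of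
Lemma 11.5). [cite: GuthMaynard2026, proof of Lemma 11.5] -/
theorem sum_normSq_Rfun_eq (W : Finset ℝ) {M : ℕ} (hM : 1 ≤ M) :
    ∑ n₁ ∈ Finset.Icc M (2 * M), ∑ n₂ ∈ Finset.Icc M (2 * M), ‖Rfun W ((n₁ : ℝ) / n₂)‖ ^ 2 =
      ∑ t₁ ∈ W, ∑ t₂ ∈ W,
        ‖∑ n ∈ Finset.Icc M (2 * M), (n : ℂ) ^ ((((t₁ - t₂ : ℝ)) : ℂ) * I)‖ ^ 2 := by
  have hS : ∀ n ∈ Finset.Icc M (2 * M), n ≠ 0 := fun n hn ↦ by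
    rw [Finset.mem_Icc] at hn; omega
  have h := DoubleZetaSum.double_sum_real_eq W (Finset.Icc M (2 * M)) hS (fun _ ↦ (1 : ℝ))
  simp only [Complex.ofReal_one, one_mul, mul_one] at h
  rw [h]
  refine Finset.sum_congr rfl fun n₁ h₁ ↦ Finset.sum_congr rfl fun n₂ h₂ ↦ ?_
  rw [Rfun_natCast_div W (hS n₁ h₁) (hS n₂ h₂)]

/-- **Guth–Maynard Lemma 11.5 (Discrete second moment) from Heath-Brown's theorem.** Assume
Heath-Brown's large values estimate in the form `hHB`: for every `ε > 0` there is `C` such that for all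
`N ≥ 1`, `T ≥ 1`, `1`-bounded `a_n`, and finite `1`-separated `𝒯` contained in an interval of length
`T`, `∑_{t₁,t₂∈𝒯} |∑_{N≤n≤2N} a_n n^{i(t₁−t₂)}|² ≤ C T^ε (|𝒯|²N + |𝒯|N² + |𝒯|^{5/4}T^{1/2}N)`
[Heath-Brown 1979; Theorem "Heath-Brown" of §6 of the paper]. Then for finite `1`-separated
`W ⊂ [t₀, t₀+T]` and `M ≥ 1`:
`∑_{n₁,n₂∈[M,2M]} |R(n₁/n₂)|² ≤ C T^ε (|W|²M + |W|M² + |W|^{5/4}T^{1/2}M)`.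
[cite: GuthMaynard2026, Lemma 11.5] -/
theorem discrete_second_moment_of_HB
    (hHB : ∀ ε : ℝ, 0 < ε → ∃ C : ℝ, 0 ≤ C ∧ ∀ (N : ℕ) (T t₀ : ℝ) (a : ℕ → ℂ) (𝒯 : Finset ℝ),
      1 ≤ N → 1 ≤ T → (∀ n, ‖a n‖ ≤ 1) → (∀ t ∈ 𝒯, t₀ ≤ t ∧ t ≤ t₀ + T) →
      (∀ t ∈ 𝒯, ∀ t' ∈ 𝒯, t ≠ t' → 1 ≤ |t - t'|) →
      ∑ t₁ ∈ 𝒯, ∑ t₂ ∈ 𝒯, ‖∑ n ∈ Finset.Icc N (2 * N), a n * (n : ℂ) ^ ((((t₁ - t₂ : ℝ)) : ℂ) * I)‖ ^ 2 ≤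
        C * T ^ ε * ((𝒯.card : ℝ) ^ 2 * N + 𝒯.card * (N : ℝ) ^ 2 +
          (𝒯.card : ℝ) ^ (5 / 4 : ℝ) * T ^ (1 / 2 : ℝ) * N))
    {ε : ℝ} (hε : 0 < ε) :
    ∃ C : ℝ, 0 ≤ C ∧ ∀ (M : ℕ) (T t₀ : ℝ) (W : Finset ℝ), 1 ≤ M → 1 ≤ T →
      (∀ t ∈ W, t₀ ≤ t ∧ t ≤ t₀ + T) → (∀ t ∈ W, ∀ t' ∈ W, t ≠ t' → 1 ≤ |t - t'|) →
      ∑ n₁ ∈ Finset.Icc M (2 * M), ∑ n₂ ∈ Finset.Icc M (2 * M), ‖Rfun W ((n₁ : ℝ) / n₂)‖ ^ 2 ≤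
        C * T ^ ε * ((W.card : ℝ) ^ 2 * M + W.card * (M : ℝ) ^ 2 +
          (W.card : ℝ) ^ (5 / 4 : ℝ) * T ^ (1 / 2 : ℝ) * M) := by
  obtain ⟨C, hC0, hC⟩ := hHB ε hε
  refine ⟨C, hC0, fun M T t₀ W hM hT hW hsep ↦ ?_⟩
  rw [sum_normSq_Rfun_eq W hM]
  have h := hC M T t₀ (fun _ ↦ (1 : ℂ)) W hM hT (fun _ ↦ by simp) hW hsep
  simp only [one_mul] at h
  exact h

/-! ## §2. `|R|⁴` as a double sum over pairs, dyadic classes of differences, and counting -/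

/-- The phase `e_{n₁,n₂}(θ) = n₁^{iθ} n₂^{-iθ}` (`= (n₁/n₂)^{iθ}`). [folklore] -/
def ePair (n₁ n₂ : ℕ) (θ : ℝ) : ℂ := (n₁ : ℂ) ^ ((θ : ℂ) * I) * (n₂ : ℂ) ^ (-((θ : ℂ) * I))

/-- The integer part of the difference of a pair: `u(t₁,t₂) = ⌊t₁ − t₂⌋`. [cite: GuthMaynard2026, proof of Lemma 11.6] -/
def uu (q : ℝ × ℝ) : ℤ := ⌊q.1 - q.2⌋

/-- The number of pairs of `W²` with a given integer part of the difference: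
`c(z) = #{(t₁,t₂) ∈ W² : ⌊t₁−t₂⌋ = z}`. [cite: GuthMaynard2026, proof of Lemma 11.6] -/
def cnt (W : Finset ℝ) (z : ℤ) : ℕ := ((W ×ˢ W).filter fun q ↦ uu q = z).card

/-- The dyadic class of a pair: `⌊log₂ c(u(q))⌋` ("`U_B := {u : #{(t₁,t₂) : ⌊t₁−t₂⌋ = u} ∼ B}`").
[cite: GuthMaynard2026, proof of Lemma 11.6] -/
def cls (W : Finset ℝ) (q : ℝ × ℝ) : ℕ := Nat.log 2 (cnt W (uu q))

/-- The pairs in the dyadic class `i`. [cite: GuthMaynard2026, proof of Lemma 11.6] -/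
def clsPairs (W : Finset ℝ) (i : ℕ) : Finset (ℝ × ℝ) := (W ×ˢ W).filter fun q ↦ cls W q = i

/-- `|e_{n₁,n₂}(θ)| = 1` for `n₁, n₂ ≥ 1`. [folklore] -/
theorem norm_ePair {n₁ n₂ : ℕ} (h₁ : n₁ ≠ 0) (h₂ : n₂ ≠ 0) (θ : ℝ) : ‖ePair n₁ n₂ θ‖ = 1 := by
  rw [ePair, norm_mul, Complex.norm_natCast_cpow_of_pos (Nat.pos_of_ne_zero h₁),
    Complex.norm_natCast_cpow_of_pos (Nat.pos_of_ne_zero h₂)]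
  simp

/-- `e(θ) conj(e(θ')) = e(θ − θ')`. [folklore] -/
theorem ePair_mul_conj {n₁ n₂ : ℕ} (h₁ : n₁ ≠ 0) (h₂ : n₂ ≠ 0) (θ θ' : ℝ) :
    ePair n₁ n₂ θ * (starRingEnd ℂ) (ePair n₁ n₂ θ') = ePair n₁ n₂ (θ - θ') := by
  have hn₁ : (n₁ : ℂ) ≠ 0 := by exact_mod_cast h₁
  have hn₂ : (n₂ : ℂ) ≠ 0 := by exact_mod_cast h₂
  simp only [ePair]
  rw [map_mul, DoubleZetaSum.conj_natCast_cpow, DoubleZetaSum.conj_natCast_cpow, map_neg,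
    DoubleZetaSum.conj_ofReal_mul_I, neg_neg]
  have e1 : (((θ - θ' : ℝ)) : ℂ) * I = (θ : ℂ) * I + (-((θ' : ℂ) * I)) := by push_cast; ring
  have e2 : -((((θ - θ' : ℝ)) : ℂ) * I) = (-((θ : ℂ) * I)) + (θ' : ℂ) * I := by push_cast; ring
  rw [e2, e1, Complex.cpow_add _ _ hn₁, Complex.cpow_add _ _ hn₂]
  ring

/-- **`|R(n₁/n₂)|² = ∑_{(t₁,t₂)∈W²} e_{n₁,n₂}(t₁ − t₂)`**. [cite: GuthMaynard2026, proof of Lemma 11.6] -/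
theorem normSq_Rfun_eq_sum_pairs (W : Finset ℝ) {n₁ n₂ : ℕ} (h₁ : n₁ ≠ 0) (h₂ : n₂ ≠ 0) :
    (((‖Rfun W ((n₁ : ℝ) / n₂)‖ ^ 2 : ℝ)) : ℂ) = ∑ q ∈ W ×ˢ W, ePair n₁ n₂ (q.1 - q.2) := by
  rw [Complex.ofReal_pow, ← Complex.mul_conj', Rfun_natCast_div W h₁ h₂, map_sum, Finset.sum_mul_sum,
    Finset.sum_product]
  refine Finset.sum_congr rfl fun t₁ _ ↦ Finset.sum_congr rfl fun t₂ _ ↦ ?_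
  exact ePair_mul_conj h₁ h₂ t₁ t₂

/-- Finite Cauchy–Schwarz: `|∑_{i∈I} z_i|² ≤ |I| ∑_{i∈I} |z_i|²` (private copy of a folklore helper also
in `LargeValuesS2Bound.lean`). [folklore] -/
private theorem norm_sum_sq_le_card_mul {ι : Type*} (I' : Finset ι) (z : ι → ℂ) :
    ‖∑ i ∈ I', z i‖ ^ 2 ≤ I'.card * ∑ i ∈ I', ‖z i‖ ^ 2 := by
  have h1 : ‖∑ i ∈ I', z i‖ ≤ ∑ i ∈ I', ‖z i‖ := norm_sum_le _ _
  have h2 := Finset.sum_mul_sq_le_sq_mul_sq I' (fun _ ↦ (1 : ℝ)) (fun i ↦ ‖z i‖)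
  simp only [one_mul, one_pow, Finset.sum_const, nsmul_eq_mul, mul_one] at h2
  calc ‖∑ i ∈ I', z i‖ ^ 2 ≤ (∑ i ∈ I', ‖z i‖) ^ 2 := pow_le_pow_left₀ (norm_nonneg _) h1 2
    _ ≤ _ := h2

/-- **`|R|⁴` controlled by the dyadic pieces**: with `Y_i = ∑_{q ∈ clsPairs W i} e(θ_q)` and
`classes = (W²).image cls`, `|R(n₁/n₂)|⁴ ≤ #classes · ∑_{i∈classes} |Y_i|²` ("using Cauchy–Schwarz,
`|R(x)|⁴ ⪅ ∑_{B} |∑_{u∈U_B} ∑ x^{i(t₁−t₂)}|²`"). [cite: GuthMaynard2026, proof of Lemma 11.6] -/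
theorem norm_Rfun_pow_four_le (W : Finset ℝ) {n₁ n₂ : ℕ} (h₁ : n₁ ≠ 0) (h₂ : n₂ ≠ 0) :
    ‖Rfun W ((n₁ : ℝ) / n₂)‖ ^ 4 ≤ ((W ×ˢ W).image (cls W)).card *
      ∑ i ∈ (W ×ˢ W).image (cls W), ‖∑ q ∈ clsPairs W i, ePair n₁ n₂ (q.1 - q.2)‖ ^ 2 := by
  have hsq : ‖Rfun W ((n₁ : ℝ) / n₂)‖ ^ 4 = ‖∑ q ∈ W ×ˢ W, ePair n₁ n₂ (q.1 - q.2)‖ ^ 2 := by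
    rw [← normSq_Rfun_eq_sum_pairs W h₁ h₂, Complex.norm_real, Real.norm_eq_abs,
      abs_of_nonneg (sq_nonneg _)]; ring
  rw [hsq, ← Finset.sum_fiberwise_of_maps_to (g := cls W) (t := (W ×ˢ W).image (cls W))
    (fun q hq ↦ Finset.mem_image_of_mem _ hq)]
  exact norm_sum_sq_le_card_mul _ _

/-- **Summing `|Y|²` over `n₁, n₂`**: for any finite set `Q` of pairs,
`∑_{n₁,n₂∈[M,2M]} |∑_{q∈Q} e_{n₁,n₂}(θ_q)|² = ∑_{q,q'∈Q} |∑_{n∈[M,2M]} n^{i(θ_q−θ_{q'})}|²`.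
[cite: GuthMaynard2026, proof of Lemma 11.6] -/
theorem sum_normSq_Y_eq (Q : Finset (ℝ × ℝ)) {M : ℕ} (hM : 1 ≤ M) :
    ∑ n₁ ∈ Finset.Icc M (2 * M), ∑ n₂ ∈ Finset.Icc M (2 * M),
      ‖∑ q ∈ Q, ePair n₁ n₂ (q.1 - q.2)‖ ^ 2 =
      ∑ q ∈ Q, ∑ q' ∈ Q, ‖∑ n ∈ Finset.Icc M (2 * M),
        (n : ℂ) ^ (((((q.1 - q.2) - (q'.1 - q'.2) : ℝ)) : ℂ) * I)‖ ^ 2 := by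
  set S := Finset.Icc M (2 * M) with hS
  have hS0 : ∀ n ∈ S, n ≠ 0 := fun n hn ↦ by rw [hS, Finset.mem_Icc] at hn; omega
  -- work in `ℂ`
  have key : ∀ n₁ ∈ S, ∀ n₂ ∈ S, (((‖∑ q ∈ Q, ePair n₁ n₂ (q.1 - q.2)‖ ^ 2 : ℝ)) : ℂ) =
      ∑ q ∈ Q, ∑ q' ∈ Q, ePair n₁ n₂ ((q.1 - q.2) - (q'.1 - q'.2)) := by
    intro n₁ h₁ n₂ h₂
    rw [Complex.ofReal_pow, ← Complex.mul_conj', map_sum, Finset.sum_mul_sum]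
    exact Finset.sum_congr rfl fun q _ ↦ Finset.sum_congr rfl fun q' _ ↦
      ePair_mul_conj (hS0 n₁ h₁) (hS0 n₂ h₂) _ _
  have key2 : ∀ Δ : ℝ, (((‖∑ n ∈ S, (n : ℂ) ^ ((Δ : ℂ) * I)‖ ^ 2 : ℝ)) : ℂ) =
      ∑ n₁ ∈ S, ∑ n₂ ∈ S, ePair n₁ n₂ Δ := by
    intro Δ
    rw [Complex.ofReal_pow, ← Complex.mul_conj', map_sum, Finset.sum_mul_sum]
    refine Finset.sum_congr rfl fun n₁ _ ↦ Finset.sum_congr rfl fun n₂ _ ↦ ?_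
    rw [DoubleZetaSum.conj_natCast_cpow, DoubleZetaSum.conj_ofReal_mul_I, ePair]
  have h : (((∑ n₁ ∈ S, ∑ n₂ ∈ S, ‖∑ q ∈ Q, ePair n₁ n₂ (q.1 - q.2)‖ ^ 2 : ℝ)) : ℂ) =
      (((∑ q ∈ Q, ∑ q' ∈ Q, ‖∑ n ∈ S, (n : ℂ) ^ (((((q.1 - q.2) - (q'.1 - q'.2) : ℝ)) : ℂ) * I)‖ ^ 2
        : ℝ)) : ℂ) := by
    simp only [Complex.ofReal_sum]
    rw [Finset.sum_congr rfl fun n₁ h₁ ↦ Finset.sum_congr rfl fun n₂ h₂ ↦ key n₁ h₁ n₂ h₂]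
    simp_rw [key2]
    exact DoubleZetaSum.sum_comm₄ S Q (fun n₁ n₂ q q' ↦ ePair n₁ n₂ ((q.1 - q.2) - (q'.1 - q'.2)))
  exact_mod_cast h

/-- Class bounds: for `q ∈ clsPairs W i`, `2^i ≤ c(u(q)) < 2^{i+1}`. [folklore] -/
theorem cnt_bounds_of_mem {W : Finset ℝ} {i : ℕ} {q : ℝ × ℝ} (hq : q ∈ clsPairs W i) :
    2 ^ i ≤ cnt W (uu q) ∧ cnt W (uu q) < 2 ^ (i + 1) := by
  rw [clsPairs, Finset.mem_filter] at hq
  obtain ⟨hqW, hcls⟩ := hq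
  have hpos : cnt W (uu q) ≠ 0 := by
    rw [cnt]; exact Finset.card_ne_zero.mpr ⟨q, Finset.mem_filter.mpr ⟨hqW, rfl⟩⟩
  rw [cls] at hcls
  constructor
  · rw [← hcls]; exact Nat.pow_log_le_self 2 hpos
  · rw [← hcls]; exact Nat.lt_pow_succ_log_self one_lt_two _

/-- The total count of pairs: `∑_{z} c(z) = |W|²` over the attained `z`; in particular
`2^i · #U_i ≤ |W|²` for `U_i = (clsPairs W i).image u`. [cite: GuthMaynard2026, proof of Lemma 11.6] -/
theorem card_U_le (W : Finset ℝ) (i : ℕ) :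
    (2 : ℝ) ^ i * ((clsPairs W i).image uu).card ≤ (W.card : ℝ) ^ 2 := by
  classical
  have h1 : ∀ z ∈ (clsPairs W i).image uu, (2 : ℝ) ^ i ≤ cnt W z := by
    intro z hz
    rw [Finset.mem_image] at hz
    obtain ⟨q, hq, rfl⟩ := hz
    exact_mod_cast (cnt_bounds_of_mem hq).1
  have h2 : ∑ z ∈ (clsPairs W i).image uu, (cnt W z : ℝ) ≤ (W.card : ℝ) ^ 2 := by
    have : ∑ z ∈ (clsPairs W i).image uu, (cnt W z : ℝ) ≤ ∑ z ∈ (W ×ˢ W).image uu, (cnt W z : ℝ) :=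
      Finset.sum_le_sum_of_subset_of_nonneg (Finset.image_subset_image (Finset.filter_subset _ _))
        fun _ _ _ ↦ by positivity
    refine this.trans (le_of_eq ?_)
    rw [← Nat.cast_sum]
    simp only [cnt]
    rw [← Finset.card_eq_sum_card_image uu (W ×ˢ W), Finset.card_product]
    push_cast; ring
  calc (2 : ℝ) ^ i * ((clsPairs W i).image uu).card = ∑ _z ∈ (clsPairs W i).image uu, (2 : ℝ) ^ i := by
        rw [Finset.sum_const, nsmul_eq_mul]; ring
    _ ≤ ∑ z ∈ (clsPairs W i).image uu, (cnt W z : ℝ) := Finset.sum_le_sum h1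
    _ ≤ _ := h2

/-- **The energy controls the dyadic classes**: `(2^i)² · #U_i ≤ E(W)` where
`E(W) = #{(t₁,t₂,t₃,t₄) ∈ W⁴ : |t₁+t₂−t₃−t₄| ≤ 1}` ("`B²|U_B| ≤ E(W)`"): pairs `q, q'` in the same fibre
`⌊t₁−t₂⌋ = ⌊t₁'−t₂'⌋` give the quadruple `(t₁, t₂', t₂, t₁')` with `|t₁ + t₂' − t₂ − t₁'| < 1`.
[cite: GuthMaynard2026, proof of Lemma 11.6] -/
theorem sq_mul_card_U_le_energy (W : Finset ℝ) (i : ℕ) :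
    ((2 : ℝ) ^ i) ^ 2 * ((clsPairs W i).image uu).card ≤
      ((((W ×ˢ W) ×ˢ (W ×ˢ W)).filter
        (fun q : (ℝ × ℝ) × (ℝ × ℝ) ↦ |q.1.1 + q.1.2 - q.2.1 - q.2.2| ≤ 1)).card : ℝ) := by
  classical
  set U := (clsPairs W i).image uu with hU
  set fib : ℤ → Finset (ℝ × ℝ) := fun z ↦ (W ×ˢ W).filter fun q ↦ uu q = z with hfib
  -- the disjoint union of the squares of the fibres
  set Sq : Finset ((ℝ × ℝ) × (ℝ × ℝ)) := U.biUnion fun z ↦ fib z ×ˢ fib z with hSq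
  have hdisj : (U : Set ℤ).PairwiseDisjoint fun z ↦ fib z ×ˢ fib z := by
    intro z _ z' _ hne
    rw [Function.onFun, Finset.disjoint_left]
    intro p hp hp'
    rw [Finset.mem_product] at hp hp'
    have h1 := (Finset.mem_filter.mp hp.1).2
    have h2 := (Finset.mem_filter.mp hp'.1).2
    exact hne (h1.symm.trans h2)
  have hcardSq : (Sq.card : ℝ) = ∑ z ∈ U, ((fib z).card : ℝ) ^ 2 := by
    rw [hSq, Finset.card_biUnion hdisj]
    push_cast
    refine Finset.sum_congr rfl fun z _ ↦ ?_
    rw [Finset.card_product]; push_cast; ring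
  -- lower bound: each fibre over `U` has at least `2^i` elements
  have hlow : ((2 : ℝ) ^ i) ^ 2 * U.card ≤ Sq.card := by
    rw [hcardSq]
    have : ∀ z ∈ U, ((2 : ℝ) ^ i) ^ 2 ≤ ((fib z).card : ℝ) ^ 2 := by
      intro z hz
      rw [hU, Finset.mem_image] at hz
      obtain ⟨q, hq, rfl⟩ := hz
      have h := (cnt_bounds_of_mem hq).1
      have h' : ((2 : ℝ) ^ i) ≤ (fib (uu q)).card := by
        rw [hfib]; exact_mod_cast h
      exact pow_le_pow_left₀ (by positivity) h' 2
    calc ((2 : ℝ) ^ i) ^ 2 * U.card = ∑ _z ∈ U, ((2 : ℝ) ^ i) ^ 2 := by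
          rw [Finset.sum_const, nsmul_eq_mul]; ring
      _ ≤ _ := Finset.sum_le_sum this
  -- upper bound: inject into the energy quadruples
  set φ : (ℝ × ℝ) × (ℝ × ℝ) → (ℝ × ℝ) × (ℝ × ℝ) := fun p ↦ ((p.1.1, p.2.2), (p.1.2, p.2.1)) with hφ
  have hinj : Set.InjOn φ (Sq : Set ((ℝ × ℝ) × (ℝ × ℝ))) := by
    intro p _ p' _ h
    simp only [hφ, Prod.mk.injEq] at h
    obtain ⟨⟨h1, h2⟩, h3, h4⟩ := h
    ext <;> assumption
  have hmaps : ∀ p ∈ Sq, φ p ∈ ((W ×ˢ W) ×ˢ (W ×ˢ W)).filter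
      (fun q : (ℝ × ℝ) × (ℝ × ℝ) ↦ |q.1.1 + q.1.2 - q.2.1 - q.2.2| ≤ 1) := by
    intro p hp
    rw [hSq, Finset.mem_biUnion] at hp
    obtain ⟨z, _, hpz⟩ := hp
    rw [Finset.mem_product] at hpz
    obtain ⟨hq, hq'⟩ := hpz
    rw [hfib, Finset.mem_filter, Finset.mem_product] at hq hq'
    obtain ⟨⟨hq1, hq2⟩, hzq⟩ := hq
    obtain ⟨⟨hq1', hq2'⟩, hzq'⟩ := hq'
    simp only [hφ, Finset.mem_filter, Finset.mem_product]
    refine ⟨⟨⟨hq1, hq2'⟩, hq2, hq1'⟩, ?_⟩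
    have hfl : ⌊p.1.1 - p.1.2⌋ = ⌊p.2.1 - p.2.2⌋ := by
      rw [uu] at hzq hzq'; exact hzq.trans hzq'.symm
    have := Int.abs_sub_lt_one_of_floor_eq_floor hfl
    rw [show p.1.1 + p.2.2 - p.1.2 - p.2.1 = (p.1.1 - p.1.2) - (p.2.1 - p.2.2) by ring]
    exact this.le
  have hup : Sq.card ≤ (((W ×ˢ W) ×ˢ (W ×ˢ W)).filter
      (fun q : (ℝ × ℝ) × (ℝ × ℝ) ↦ |q.1.1 + q.1.2 - q.2.1 - q.2.2| ≤ 1)).card :=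
    Finset.card_le_card_of_injOn φ hmaps hinj
  exact hlow.trans (by exact_mod_cast hup)

/-- **Regrouping a double sum over a class by the fibres**: for `F ≥ 0`,
`∑_{q,q'∈clsPairs W i} F(u(q), u(q')) ≤ (2^{i+1})² ∑_{z,z'∈U_i} F(z,z')` ("`≲ B² ∑_{u₁,u₂∈U_B}`").
[cite: GuthMaynard2026, proof of Lemma 11.6] -/
theorem sum_cls_le_sum_U (W : Finset ℝ) (i : ℕ) (F : ℤ → ℤ → ℝ) (hF : ∀ z z', 0 ≤ F z z') :
    ∑ q ∈ clsPairs W i, ∑ q' ∈ clsPairs W i, F (uu q) (uu q') ≤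
      ((2 : ℝ) ^ (i + 1)) ^ 2 * ∑ z ∈ (clsPairs W i).image uu, ∑ z' ∈ (clsPairs W i).image uu, F z z' := by
  classical
  set Q := clsPairs W i with hQ
  set U := Q.image uu with hU
  set c : ℤ → ℕ := fun z ↦ (Q.filter fun q ↦ uu q = z).card with hc
  have hcle : ∀ z, (c z : ℝ) ≤ (2 : ℝ) ^ (i + 1) := by
    intro z
    by_cases hz : ∃ q ∈ Q, uu q = z
    · obtain ⟨q, hq, rfl⟩ := hz
      have h := (cnt_bounds_of_mem hq).2
      have h1 : c (uu q) ≤ cnt W (uu q) := by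
        simp only [hc, cnt]
        exact Finset.card_le_card (Finset.filter_subset_filter _ (Finset.filter_subset _ _))
      have : (c (uu q) : ℝ) ≤ cnt W (uu q) := by exact_mod_cast h1
      have : (cnt W (uu q) : ℝ) < (2 : ℝ) ^ (i + 1) := by exact_mod_cast h
      linarith
    · have : c z = 0 := by
        simp only [hc]
        rw [Finset.card_eq_zero, Finset.filter_eq_empty_iff]
        intro q hq h; exact hz ⟨q, hq, h⟩
      rw [this, Nat.cast_zero]; positivity
  -- fibrewise in `q`, then in `q'`
  have h1 : ∀ G : ℤ → ℝ, (∀ z, 0 ≤ G z) → ∑ q ∈ Q, G (uu q) ≤ (2 : ℝ) ^ (i + 1) * ∑ z ∈ U, G z := by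
    intro G hG
    rw [← Finset.sum_fiberwise_of_maps_to (g := uu) (t := U) (fun q hq ↦ Finset.mem_image_of_mem _ hq),
      Finset.mul_sum]
    refine Finset.sum_le_sum fun z _ ↦ ?_
    have : ∑ q ∈ Q.filter (fun q ↦ uu q = z), G (uu q) = (c z : ℝ) * G z := by
      rw [Finset.sum_congr rfl (fun q hq ↦ by rw [(Finset.mem_filter.mp hq).2] :
        ∀ q ∈ Q.filter (fun q ↦ uu q = z), G (uu q) = G z), Finset.sum_const, nsmul_eq_mul]
    rw [this]
    exact mul_le_mul_of_nonneg_right (hcle z) (hG z)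
  calc ∑ q ∈ Q, ∑ q' ∈ Q, F (uu q) (uu q')
      ≤ ∑ q ∈ Q, (2 : ℝ) ^ (i + 1) * ∑ z' ∈ U, F (uu q) z' :=
        Finset.sum_le_sum fun q _ ↦ h1 (fun z' ↦ F (uu q) z') (fun z' ↦ hF _ _)
    _ = (2 : ℝ) ^ (i + 1) * ∑ q ∈ Q, (fun z ↦ ∑ z' ∈ U, F z z') (uu q) := by
        rw [Finset.mul_sum]
    _ ≤ (2 : ℝ) ^ (i + 1) * ((2 : ℝ) ^ (i + 1) * ∑ z ∈ U, ∑ z' ∈ U, F z z') := by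
        refine mul_le_mul_of_nonneg_left (h1 _ fun z ↦ Finset.sum_nonneg fun z' _ ↦ hF z z') ?_
        positivity
    _ = _ := by ring

/-! ## §3. Smoothing in the difference variable and Heath-Brown at a fixed shift -/

section bump

variable {ψ : ℝ → ℝ}

/-- **Smoothing (Lemma 11.3) for `D(v) = ∑_{M≤n≤2M} n^{iv}` in the form needed for Lemma 11.6**: with
`k = |ψ̂| ≤ K min(1, ξ^{-2})`, `A = max(1, ‖ψ̂‖₁)` and the majorant `g`, for `|s| ≤ 1`,
`|D(z + s)|² ≤ A ∫ g(t) |D(z + t)|² dt` ("By using Lemma 11.3 to replace the supremum with an integral").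
[cite: GuthMaynard2026, proof of Lemma 11.6] -/
theorem normSq_D_shift_le (hψ : ContDiff ℝ ∞ ψ) (hψs : HasCompactSupport ψ)
    (hψ1 : ∀ x : ℝ, 0 ≤ x → x ≤ Real.log 2 / (2 * π) → ψ x = 1) {K : ℝ} (hK0 : 0 ≤ K)
    (hKb : ∀ ξ, ‖𝓕 (fun y ↦ (ψ y : ℂ)) ξ‖ ≤ K)
    (hKd : ∀ ξ, ξ ≠ 0 → ‖𝓕 (fun y ↦ (ψ y : ℂ)) ξ‖ ≤ K / |ξ| ^ 2) {M : ℕ} (hM : 1 ≤ M) (z : ℝ)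
    {s : ℝ} (hs : |s| ≤ 1) :
    ‖∑ n ∈ Finset.Icc M (2 * M), (n : ℂ) ^ ((((z + s : ℝ)) : ℂ) * I)‖ ^ 2 ≤
      max 1 (∫ v, ‖𝓕 (fun y ↦ (ψ y : ℂ)) v‖) *
        ∫ t, (if |t| ≤ 2 then K else 4 * K / t ^ 2) *
          ‖∑ n ∈ Finset.Icc M (2 * M), (n : ℂ) ^ ((((z + t : ℝ)) : ℂ) * I)‖ ^ 2 := by
  set F : ℝ → ℂ := 𝓕 (fun y ↦ (ψ y : ℂ)) with hF
  have hFi : Integrable F := integrable_fourier_bump hψ hψs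
  set A : ℝ := max 1 (∫ v, ‖F v‖) with hA
  have hA0 : 0 ≤ A := le_trans zero_le_one (le_max_left _ _)
  set g : ℝ → ℝ := fun t ↦ if |t| ≤ 2 then K else 4 * K / t ^ 2 with hg
  have hgi : Integrable g := integrable_majorant K
  set D : ℝ → ℂ := fun v ↦ ∑ n ∈ Finset.Icc M (2 * M), (n : ℂ) ^ ((v : ℂ) * I) with hD
  -- `D` bounded and continuous
  have hDle : ∀ v : ℝ, ‖D v‖ ≤ (M : ℝ) + 1 := by
    intro v
    refine (norm_sum_le _ _).trans ?_
    have : ∀ n ∈ Finset.Icc M (2 * M), ‖(n : ℂ) ^ ((v : ℂ) * I)‖ ≤ 1 := by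
      intro n hn
      rw [Finset.mem_Icc] at hn
      rw [Complex.norm_natCast_cpow_of_pos (by omega)]; simp
    refine (Finset.sum_le_sum this).trans ?_
    rw [Finset.sum_const, Nat.card_Icc, nsmul_eq_mul, mul_one]
    have : (2 * M + 1 - M : ℕ) = M + 1 := by omega
    rw [this]; push_cast; exact le_rfl
  have hDcont : Continuous D := by
    refine continuous_finsetSum _ fun n hn ↦ ?_
    rw [Finset.mem_Icc] at hn
    have : (fun v : ℝ ↦ (n : ℂ) ^ ((v : ℂ) * I)) =
        fun v : ℝ ↦ Complex.exp (Complex.log n * ((v : ℂ) * I)) := by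
      ext v; rw [Complex.cpow_def_of_ne_zero (by exact_mod_cast (show n ≠ 0 by omega))]
    rw [this]; fun_prop
  -- smoothing bound at `z + s`
  have h1 := smoothing_bound hψ hψs hψ1 hM (fun _ ↦ (1 : ℂ)) (z + s)
  simp only [one_mul] at h1
  change ‖D (z + s)‖ ^ 2 ≤ A * ∫ v, ‖F v‖ * ‖D (z + s + v)‖ ^ 2 at h1
  refine h1.trans (mul_le_mul_of_nonneg_left ?_ hA0)
  -- substitute `v = t − s`
  have hsub : ∫ v, ‖F v‖ * ‖D (z + s + v)‖ ^ 2 = ∫ t, ‖F (t - s)‖ * ‖D (z + t)‖ ^ 2 := by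
    rw [← integral_sub_right_eq_self (fun v ↦ ‖F v‖ * ‖D (z + s + v)‖ ^ 2) s]
    refine integral_congr_ae (Eventually.of_forall fun t ↦ ?_)
    simp only
    rw [show z + s + (t - s) = z + t by ring]
  rw [hsub]
  have hI1 : Integrable (fun t ↦ ‖F (t - s)‖ * ‖D (z + t)‖ ^ 2) :=
    (hFi.comp_sub_right s).norm.mul_bdd (c := ((M : ℝ) + 1) ^ 2)
      (((hDcont.comp (continuous_const_add z)).norm.pow 2).aestronglyMeasurable)
      (Eventually.of_forall fun t ↦ by
        rw [Real.norm_eq_abs, abs_of_nonneg (sq_nonneg _)]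
        exact pow_le_pow_left₀ (norm_nonneg _) (hDle _) 2)
  have hI2 : Integrable (fun t ↦ g t * ‖D (z + t)‖ ^ 2) :=
    hgi.mul_bdd (c := ((M : ℝ) + 1) ^ 2)
      (((hDcont.comp (continuous_const_add z)).norm.pow 2).aestronglyMeasurable)
      (Eventually.of_forall fun t ↦ by
        rw [Real.norm_eq_abs, abs_of_nonneg (sq_nonneg _)]
        exact pow_le_pow_left₀ (norm_nonneg _) (hDle _) 2)
  refine integral_mono hI1 hI2 fun t ↦ ?_
  have hx : |(-s)| ≤ 1 := by rwa [abs_neg]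
  have := kernel_shift_le (k := fun ξ ↦ ‖F ξ‖) hK0 hKb hKd hx t
  rw [show t + -s = t - s by ring] at this
  exact mul_le_mul_of_nonneg_right this (sq_nonneg _)

end bump

/-- **Heath-Brown's theorem at a fixed shift, for a set of integers**: under `hHB`, for a finite set
`U ⊂ ℤ ∩ [−T−1, T]` (`T ≥ 1`), `M ≥ 1` and real `t`,
`∑_{z,z'∈U} |∑_{M≤n≤2M} n^{i(z−z'+t)}|² ≤ C (3T)^ε (|U|²M + |U|M² + |U|^{5/4}(3T)^{1/2}M)`
(Heath-Brown applied to the `1`-separated set `U` and the coefficients `a_n = n^{it}`).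
[cite: GuthMaynard2026, proof of Lemma 11.6] -/
theorem HB_fixed_shift
    (hHB : ∀ ε : ℝ, 0 < ε → ∃ C : ℝ, 0 ≤ C ∧ ∀ (N : ℕ) (T t₀ : ℝ) (a : ℕ → ℂ) (𝒯 : Finset ℝ),
      1 ≤ N → 1 ≤ T → (∀ n, ‖a n‖ ≤ 1) → (∀ t ∈ 𝒯, t₀ ≤ t ∧ t ≤ t₀ + T) →
      (∀ t ∈ 𝒯, ∀ t' ∈ 𝒯, t ≠ t' → 1 ≤ |t - t'|) →
      ∑ t₁ ∈ 𝒯, ∑ t₂ ∈ 𝒯, ‖∑ n ∈ Finset.Icc N (2 * N), a n * (n : ℂ) ^ ((((t₁ - t₂ : ℝ)) : ℂ) * I)‖ ^ 2 ≤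
        C * T ^ ε * ((𝒯.card : ℝ) ^ 2 * N + 𝒯.card * (N : ℝ) ^ 2 +
          (𝒯.card : ℝ) ^ (5 / 4 : ℝ) * T ^ (1 / 2 : ℝ) * N))
    {ε : ℝ} (hε : 0 < ε) :
    ∃ C : ℝ, 0 ≤ C ∧ ∀ (M : ℕ) (T : ℝ) (U : Finset ℤ) (t : ℝ), 1 ≤ M → 1 ≤ T →
      (∀ z ∈ U, -T - 1 ≤ (z : ℝ) ∧ (z : ℝ) ≤ T) →
      ∑ z ∈ U, ∑ z' ∈ U, ‖∑ n ∈ Finset.Icc M (2 * M),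
        (n : ℂ) ^ (((((z : ℝ) - (z' : ℝ) + t : ℝ)) : ℂ) * I)‖ ^ 2 ≤
        C * (3 * T) ^ ε * ((U.card : ℝ) ^ 2 * M + U.card * (M : ℝ) ^ 2 +
          (U.card : ℝ) ^ (5 / 4 : ℝ) * (3 * T) ^ (1 / 2 : ℝ) * M) := by
  obtain ⟨C, hC0, hC⟩ := hHB ε hε
  refine ⟨C, hC0, fun M T U t hM hT hU ↦ ?_⟩
  classical
  set 𝒯 : Finset ℝ := U.image (Int.cast) with h𝒯
  have hinj : Function.Injective (Int.cast : ℤ → ℝ) := Int.cast_injective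
  have hcard : 𝒯.card = U.card := Finset.card_image_of_injective _ hinj
  have h := hC M (3 * T) (-T - 1) (fun n ↦ (n : ℂ) ^ ((t : ℂ) * I)) 𝒯 hM (by linarith) ?_ ?_ ?_
  · rw [hcard] at h
    refine le_trans (le_of_eq ?_) h
    rw [h𝒯, Finset.sum_image (fun z _ z' _ h ↦ hinj h)]
    refine Finset.sum_congr rfl fun z _ ↦ ?_
    rw [Finset.sum_image (fun z _ z' _ h ↦ hinj h)]
    refine Finset.sum_congr rfl fun z' _ ↦ ?_
    congr 2
    refine Finset.sum_congr rfl fun n hn ↦ ?_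
    rw [Finset.mem_Icc] at hn
    rw [← Complex.cpow_add _ _ (by exact_mod_cast (show n ≠ 0 by omega))]
    congr 1; push_cast; ring
  · intro n
    rcases Nat.eq_zero_or_pos n with h0 | hpos
    · subst h0
      simp only [Nat.cast_zero]
      by_cases ht : ((t : ℂ) * I) = 0
      · rw [ht, Complex.cpow_zero]; simp
      · rw [Complex.zero_cpow ht]; simp
    · rw [Complex.norm_natCast_cpow_of_pos hpos]; simp
  · intro u hu
    rw [h𝒯, Finset.mem_image] at hu
    obtain ⟨z, hz, rfl⟩ := hu
    have := hU z hz
    constructor <;> linarith [this.1, this.2]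
  · intro u hu u' hu' hne
    rw [h𝒯, Finset.mem_image] at hu hu'
    obtain ⟨z, _, rfl⟩ := hu
    obtain ⟨z', _, rfl⟩ := hu'
    have hzz : z ≠ z' := fun h ↦ hne (by rw [h])
    rw [← Int.cast_sub, ← Int.cast_abs]
    have : (1 : ℤ) ≤ |z - z'| := Int.one_le_abs (sub_ne_zero.mpr hzz)
    exact_mod_cast this

/-! ## §4. Guth–Maynard Lemma 11.6 (Discrete fourth moment) from Heath-Brown's theorem -/

/-- The algebra of the class bounds: with `B U ≤ |W|²` and `B² U ≤ E`,
`(2B)² (U²M + UM² + U^{5/4}T'^{1/2}M) ≤ 4 (|W|⁴M + E M² + E^{3/4}|W| T'^{1/2} M)`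
("We have that `B|U_B| ≤ |W|²` and `B²|U_B| ≤ E(W)`, so this gives …"). [cite: GuthMaynard2026, proof of Lemma 11.6] -/
theorem class_algebra {B U Wc E M T' : ℝ} (hB : 0 < B) (hU : 0 ≤ U) (hWc : 0 ≤ Wc) (hE : 0 ≤ E)
    (hM : 0 ≤ M) (hT' : 0 ≤ T') (h1 : B * U ≤ Wc ^ 2) (h2 : B ^ 2 * U ≤ E) :
    (2 * B) ^ 2 * (U ^ 2 * M + U * M ^ 2 + U ^ (5 / 4 : ℝ) * T' ^ (1 / 2 : ℝ) * M) ≤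
      4 * (Wc ^ 4 * M + E * M ^ 2 + E ^ (3 / 4 : ℝ) * Wc * T' ^ (1 / 2 : ℝ) * M) := by
  have e1 : (2 * B) ^ 2 * (U ^ 2 * M) = 4 * ((B * U) ^ 2 * M) := by ring
  have e2 : (2 * B) ^ 2 * (U * M ^ 2) = 4 * ((B ^ 2 * U) * M ^ 2) := by ring
  have e3 : (2 * B) ^ 2 * (U ^ (5 / 4 : ℝ) * T' ^ (1 / 2 : ℝ) * M) =
      4 * ((B ^ 2 * U ^ (5 / 4 : ℝ)) * T' ^ (1 / 2 : ℝ) * M) := by ring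
  have h3 : (B * U) ^ 2 ≤ Wc ^ 4 := by
    calc (B * U) ^ 2 ≤ (Wc ^ 2) ^ 2 := pow_le_pow_left₀ (by positivity) h1 2
      _ = Wc ^ 4 := by ring
  have h4 : B ^ 2 * U ^ (5 / 4 : ℝ) ≤ E ^ (3 / 4 : ℝ) * Wc := by
    have eB : (B ^ 2) ^ (3 / 4 : ℝ) * B ^ (1 / 2 : ℝ) = B ^ 2 := by
      rw [← Real.rpow_natCast B 2, ← Real.rpow_mul hB.le, ← Real.rpow_add hB]; norm_num
    have eU : U ^ (3 / 4 : ℝ) * U ^ (1 / 2 : ℝ) = U ^ (5 / 4 : ℝ) := by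
      rw [← Real.rpow_add' hU (by norm_num)]; norm_num
    have key : (B ^ 2 * U) ^ (3 / 4 : ℝ) * (B * U) ^ (1 / 2 : ℝ) = B ^ 2 * U ^ (5 / 4 : ℝ) := by
      rw [Real.mul_rpow (by positivity) hU, Real.mul_rpow hB.le hU]
      calc (B ^ 2) ^ (3 / 4 : ℝ) * U ^ (3 / 4 : ℝ) * (B ^ (1 / 2 : ℝ) * U ^ (1 / 2 : ℝ))
          = ((B ^ 2) ^ (3 / 4 : ℝ) * B ^ (1 / 2 : ℝ)) * (U ^ (3 / 4 : ℝ) * U ^ (1 / 2 : ℝ)) := by ring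
        _ = B ^ 2 * U ^ (5 / 4 : ℝ) := by rw [eB, eU]
    rw [← key]
    have h5 : (B * U) ^ (1 / 2 : ℝ) ≤ (Wc ^ 2) ^ (1 / 2 : ℝ) :=
      Real.rpow_le_rpow (by positivity) h1 (by norm_num)
    have h6 : (Wc ^ 2) ^ (1 / 2 : ℝ) = Wc := by
      rw [← Real.rpow_natCast, ← Real.rpow_mul hWc]; norm_num
    rw [h6] at h5
    exact mul_le_mul (Real.rpow_le_rpow (by positivity) h2 (by norm_num)) h5 (by positivity)
      (by positivity)
  rw [mul_add, mul_add, e1, e2, e3, mul_add, mul_add]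
  gcongr

section bump

set_option maxHeartbeats 1600000 in
/-- **Guth–Maynard Lemma 11.6 (Discrete fourth moment) from Heath-Brown's theorem.** Under `hHB`
(Heath-Brown's theorem, as in `discrete_second_moment_of_HB`), for every `ε > 0` there is `C` such
that for all `M ≥ 1`, `T ≥ 1` and finite `1`-separated `W ⊂ [t₀, t₀+T]`,
`∑_{n₁,n₂∈[M,2M]} |R(n₁/n₂)|⁴ ≤ C T^ε L² (|W|⁴M + M²E(W) + E(W)^{3/4}|W|T^{1/2}M)`, where
`L = #{dyadic classes} ≤ log₂|W|² + 1` and `E(W) = #{|t₁+t₂−t₃−t₄| ≤ 1}` (the expression of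
`GuthMaynardAssembly.addEnergy`). Proof as in the paper: `|R|⁴ = |∑_{(t₁,t₂)} x^{i(t₁−t₂)}|²`, the pairs
grouped by `u = ⌊t₁−t₂⌋` into dyadic classes `U_B` of the multiplicity, Cauchy–Schwarz over the classes,
`∑_{n₁,n₂}|Y_B|² = ∑|D(θ_q−θ_{q'})|²`, Lemma 11.3 to replace the fractional shift by an integral,
Heath-Brown's theorem on each `U_B` with `a_n = n^{it}`, and `B|U_B| ≤ |W|²`, `B²|U_B| ≤ E(W)`.
[cite: GuthMaynard2026, Lemma 11.6] -/
theorem discrete_fourth_moment_of_HB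
    (hHB : ∀ ε : ℝ, 0 < ε → ∃ C : ℝ, 0 ≤ C ∧ ∀ (N : ℕ) (T t₀ : ℝ) (a : ℕ → ℂ) (𝒯 : Finset ℝ),
      1 ≤ N → 1 ≤ T → (∀ n, ‖a n‖ ≤ 1) → (∀ t ∈ 𝒯, t₀ ≤ t ∧ t ≤ t₀ + T) →
      (∀ t ∈ 𝒯, ∀ t' ∈ 𝒯, t ≠ t' → 1 ≤ |t - t'|) →
      ∑ t₁ ∈ 𝒯, ∑ t₂ ∈ 𝒯, ‖∑ n ∈ Finset.Icc N (2 * N), a n * (n : ℂ) ^ ((((t₁ - t₂ : ℝ)) : ℂ) * I)‖ ^ 2 ≤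
        C * T ^ ε * ((𝒯.card : ℝ) ^ 2 * N + 𝒯.card * (N : ℝ) ^ 2 +
          (𝒯.card : ℝ) ^ (5 / 4 : ℝ) * T ^ (1 / 2 : ℝ) * N))
    {ε : ℝ} (hε : 0 < ε) :
    ∃ C : ℝ, 0 ≤ C ∧ ∀ (M : ℕ) (T t₀ : ℝ) (W : Finset ℝ), 1 ≤ M → 1 ≤ T →
      (∀ t ∈ W, t₀ ≤ t ∧ t ≤ t₀ + T) → (∀ t ∈ W, ∀ t' ∈ W, t ≠ t' → 1 ≤ |t - t'|) →
      ∑ n₁ ∈ Finset.Icc M (2 * M), ∑ n₂ ∈ Finset.Icc M (2 * M), ‖Rfun W ((n₁ : ℝ) / n₂)‖ ^ 4 ≤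
        C * T ^ ε * (((W ×ˢ W).image (cls W)).card : ℝ) ^ 2 *
          ((W.card : ℝ) ^ 4 * M + (M : ℝ) ^ 2 * ((((W ×ˢ W) ×ˢ (W ×ˢ W)).filter
              (fun q : (ℝ × ℝ) × (ℝ × ℝ) ↦ |q.1.1 + q.1.2 - q.2.1 - q.2.2| ≤ 1)).card : ℝ) +
            (((((W ×ˢ W) ×ˢ (W ×ˢ W)).filter
              (fun q : (ℝ × ℝ) × (ℝ × ℝ) ↦ |q.1.1 + q.1.2 - q.2.1 - q.2.2| ≤ 1)).card : ℝ)) ^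
                (3 / 4 : ℝ) * W.card * T ^ (1 / 2 : ℝ) * M) := by
  -- constants
  obtain ⟨ψ, hψ, hψs, hψ1⟩ := exists_smoothingBump
  obtain ⟨K, hK0, hKb, hKd⟩ := exists_majorant_fourier_bump hψ hψs
  set F : ℝ → ℂ := 𝓕 (fun y ↦ (ψ y : ℂ)) with hF
  set A : ℝ := max 1 (∫ v, ‖F v‖) with hA
  have hA0 : 0 ≤ A := le_trans zero_le_one (le_max_left _ _)
  set g : ℝ → ℝ := fun t ↦ if |t| ≤ 2 then K else 4 * K / t ^ 2 with hg
  have hgi : Integrable g := integrable_majorant K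
  have hg0 : ∀ t, 0 ≤ g t := fun t ↦ by simp only [hg]; split_ifs <;> positivity
  set G₀ : ℝ := ∫ t, g t with hG₀
  have hG₀0 : 0 ≤ G₀ := integral_nonneg hg0
  obtain ⟨C₁, hC₁0, hC₁⟩ := HB_fixed_shift hHB hε
  refine ⟨4 * A * G₀ * C₁ * (3 : ℝ) ^ ε * 2, by positivity, fun M T t₀ W hM hT hW hsep ↦ ?_⟩
  classical
  have hT0 : 0 < T := by linarith
  set S := Finset.Icc M (2 * M) with hS
  have hS0 : ∀ n ∈ S, n ≠ 0 := fun n hn ↦ by rw [hS, Finset.mem_Icc] at hn; omega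
  set E₁ : ℝ := ((((W ×ˢ W) ×ˢ (W ×ˢ W)).filter
    (fun q : (ℝ × ℝ) × (ℝ × ℝ) ↦ |q.1.1 + q.1.2 - q.2.1 - q.2.2| ≤ 1)).card : ℝ) with hE₁
  have hE₁0 : 0 ≤ E₁ := by positivity
  set cl := (W ×ˢ W).image (cls W) with hcl
  set L : ℝ := (cl.card : ℝ) with hL
  set D : ℝ → ℂ := fun v ↦ ∑ n ∈ S, (n : ℂ) ^ ((v : ℂ) * I) with hD
  set X : ℝ := (W.card : ℝ) ^ 4 * M + (M : ℝ) ^ 2 * E₁ +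
    E₁ ^ (3 / 4 : ℝ) * W.card * T ^ (1 / 2 : ℝ) * M with hX
  -- `D` bounded and continuous
  have hDle : ∀ v : ℝ, ‖D v‖ ≤ (M : ℝ) + 1 := by
    intro v
    refine (norm_sum_le _ _).trans ?_
    have : ∀ n ∈ S, ‖(n : ℂ) ^ ((v : ℂ) * I)‖ ≤ 1 := by
      intro n hn
      rw [Complex.norm_natCast_cpow_of_pos (Nat.pos_of_ne_zero (hS0 n hn))]; simp
    refine (Finset.sum_le_sum this).trans ?_
    rw [Finset.sum_const, hS, Nat.card_Icc, nsmul_eq_mul, mul_one]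
    have : (2 * M + 1 - M : ℕ) = M + 1 := by omega
    rw [this]; push_cast; exact le_rfl
  have hDcont : Continuous D := by
    refine continuous_finsetSum _ fun n hn ↦ ?_
    have : (fun v : ℝ ↦ (n : ℂ) ^ ((v : ℂ) * I)) =
        fun v : ℝ ↦ Complex.exp (Complex.log n * ((v : ℂ) * I)) := by
      ext v; rw [Complex.cpow_def_of_ne_zero (by exact_mod_cast hS0 n hn)]
    rw [this]; fun_prop
  have hIg : ∀ c : ℝ, Integrable (fun t ↦ g t * ‖D (c + t)‖ ^ 2) := fun c ↦
    hgi.mul_bdd (c := ((M : ℝ) + 1) ^ 2)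
      (((hDcont.comp (continuous_const_add c)).norm.pow 2).aestronglyMeasurable)
      (Eventually.of_forall fun t ↦ by
        rw [Real.norm_eq_abs, abs_of_nonneg (sq_nonneg _)]
        exact pow_le_pow_left₀ (norm_nonneg _) (hDle _) 2)
  -- the per-class bound
  have hclass : ∀ i : ℕ, ∑ n₁ ∈ S, ∑ n₂ ∈ S,
      ‖∑ q ∈ clsPairs W i, ePair n₁ n₂ (q.1 - q.2)‖ ^ 2 ≤
      4 * A * G₀ * C₁ * (3 * T) ^ ε * ((W.card : ℝ) ^ 4 * M + E₁ * (M : ℝ) ^ 2 +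
        E₁ ^ (3 / 4 : ℝ) * W.card * (3 * T) ^ (1 / 2 : ℝ) * M) := by
    intro i
    set Q := clsPairs W i with hQ
    set U := Q.image uu with hU
    rw [sum_normSq_Y_eq Q hM]
    -- Step c: smoothing, pair by pair
    have hc : ∀ q ∈ Q, ∀ q' ∈ Q,
        ‖∑ n ∈ S, (n : ℂ) ^ (((((q.1 - q.2) - (q'.1 - q'.2) : ℝ)) : ℂ) * I)‖ ^ 2 ≤
        A * ∫ t, g t * ‖D (((uu q : ℝ) - (uu q' : ℝ)) + t)‖ ^ 2 := by
      intro q _ q' _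
      set z : ℝ := (uu q : ℝ) - (uu q' : ℝ) with hz
      set s : ℝ := Int.fract (q.1 - q.2) - Int.fract (q'.1 - q'.2) with hs
      have hs1 : |s| ≤ 1 := by
        rw [hs, abs_le]
        have := Int.fract_nonneg (q.1 - q.2); have := Int.fract_lt_one (q.1 - q.2)
        have := Int.fract_nonneg (q'.1 - q'.2); have := Int.fract_lt_one (q'.1 - q'.2)
        constructor <;> linarith
      have hdecomp : (q.1 - q.2) - (q'.1 - q'.2) = z + s := by
        rw [hz, hs, uu, uu]
        have e1 := Int.floor_add_fract (q.1 - q.2)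
        have e2 := Int.floor_add_fract (q'.1 - q'.2)
        linarith
      rw [hdecomp]
      exact normSq_D_shift_le hψ hψs hψ1 hK0 hKb hKd hM z hs1
    -- sum of Step c, and exchange of sum and integral
    have hc' : ∑ q ∈ Q, ∑ q' ∈ Q,
        ‖∑ n ∈ S, (n : ℂ) ^ (((((q.1 - q.2) - (q'.1 - q'.2) : ℝ)) : ℂ) * I)‖ ^ 2 ≤
        A * ∫ t, g t * ∑ q ∈ Q, ∑ q' ∈ Q, ‖D (((uu q : ℝ) - (uu q' : ℝ)) + t)‖ ^ 2 := by
      calc _ ≤ ∑ q ∈ Q, ∑ q' ∈ Q, A * ∫ t, g t * ‖D (((uu q : ℝ) - (uu q' : ℝ)) + t)‖ ^ 2 :=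
            Finset.sum_le_sum fun q hq ↦ Finset.sum_le_sum fun q' hq' ↦ hc q hq q' hq'
        _ = A * ∑ q ∈ Q, ∑ q' ∈ Q, ∫ t, g t * ‖D (((uu q : ℝ) - (uu q' : ℝ)) + t)‖ ^ 2 := by
            rw [Finset.mul_sum]; refine Finset.sum_congr rfl fun q _ ↦ by rw [Finset.mul_sum]
        _ = A * ∫ t, ∑ q ∈ Q, ∑ q' ∈ Q, g t * ‖D (((uu q : ℝ) - (uu q' : ℝ)) + t)‖ ^ 2 := by
            congr 1
            rw [integral_finsetSum _ (fun q _ ↦ integrable_finsetSum _ fun q' _ ↦ hIg _)]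
            exact Finset.sum_congr rfl fun q _ ↦ (integral_finsetSum _ (fun q' _ ↦ hIg _)).symm
        _ = _ := by
            congr 1
            refine integral_congr_ae (Eventually.of_forall fun t ↦ ?_)
            simp only [Finset.mul_sum]
    -- Step b + d pointwise in `t`
    have hUint : ∀ z ∈ U, -T - 1 ≤ (z : ℝ) ∧ (z : ℝ) ≤ T := by
      intro z hz
      rw [hU, Finset.mem_image] at hz
      obtain ⟨q, hq, rfl⟩ := hz
      rw [hQ, clsPairs, Finset.mem_filter, Finset.mem_product] at hq
      obtain ⟨⟨hq1, hq2⟩, _⟩ := hq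
      have h1 := hW q.1 hq1; have h2 := hW q.2 hq2
      have hfl := Int.floor_le (q.1 - q.2)
      have hfl' := Int.lt_floor_add_one (q.1 - q.2)
      rw [uu]
      constructor <;> linarith [h1.1, h1.2, h2.1, h2.2]
    set HBb : ℝ := C₁ * (3 * T) ^ ε * ((U.card : ℝ) ^ 2 * M + U.card * (M : ℝ) ^ 2 +
      (U.card : ℝ) ^ (5 / 4 : ℝ) * (3 * T) ^ (1 / 2 : ℝ) * M) with hHBb
    have hbd : ∀ t : ℝ, ∑ q ∈ Q, ∑ q' ∈ Q, ‖D (((uu q : ℝ) - (uu q' : ℝ)) + t)‖ ^ 2 ≤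
        ((2 : ℝ) ^ (i + 1)) ^ 2 * HBb := by
      intro t
      have hb := sum_cls_le_sum_U W i (fun z z' ↦ ‖D (((z : ℝ) - (z' : ℝ)) + t)‖ ^ 2)
        (fun _ _ ↦ sq_nonneg _)
      refine hb.trans (mul_le_mul_of_nonneg_left ?_ (by positivity))
      have hd := hC₁ M T U t hM hT hUint
      exact hd
    -- integrate
    have hint : ∫ t, g t * ∑ q ∈ Q, ∑ q' ∈ Q, ‖D (((uu q : ℝ) - (uu q' : ℝ)) + t)‖ ^ 2 ≤
        G₀ * (((2 : ℝ) ^ (i + 1)) ^ 2 * HBb) := by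
      have hI1 : Integrable (fun t ↦ g t * ∑ q ∈ Q, ∑ q' ∈ Q, ‖D (((uu q : ℝ) - (uu q' : ℝ)) + t)‖ ^ 2) := by
        have := integrable_finsetSum Q (fun q _ ↦ integrable_finsetSum Q fun q' _ ↦ hIg (((uu q : ℝ) - (uu q' : ℝ))))
        refine this.congr (Eventually.of_forall fun t ↦ ?_)
        simp only [Finset.mul_sum]
      calc _ ≤ ∫ t, g t * (((2 : ℝ) ^ (i + 1)) ^ 2 * HBb) :=
            integral_mono hI1 (hgi.mul_const _) fun t ↦ mul_le_mul_of_nonneg_left (hbd t) (hg0 t)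
        _ = _ := by rw [integral_mul_const]
    -- Step e: the class algebra
    have hBU := card_U_le W i
    have hB2U := sq_mul_card_U_le_energy W i
    have halg := class_algebra (B := (2 : ℝ) ^ i) (U := (U.card : ℝ)) (Wc := (W.card : ℝ))
      (E := E₁) (M := (M : ℝ)) (T' := 3 * T) (by positivity) (by positivity) (by positivity) hE₁0
      (by positivity) (by positivity) hBU hB2U
    have e2 : ((2 : ℝ) ^ (i + 1)) ^ 2 = (2 * (2 : ℝ) ^ i) ^ 2 := by ring
    calc ∑ q ∈ Q, ∑ q' ∈ Q,
          ‖∑ n ∈ S, (n : ℂ) ^ (((((q.1 - q.2) - (q'.1 - q'.2) : ℝ)) : ℂ) * I)‖ ^ 2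
        ≤ A * ∫ t, g t * ∑ q ∈ Q, ∑ q' ∈ Q, ‖D (((uu q : ℝ) - (uu q' : ℝ)) + t)‖ ^ 2 := hc'
      _ ≤ A * (G₀ * (((2 : ℝ) ^ (i + 1)) ^ 2 * HBb)) := mul_le_mul_of_nonneg_left hint hA0
      _ = A * G₀ * (C₁ * (3 * T) ^ ε) * ((2 * (2 : ℝ) ^ i) ^ 2 *
          ((U.card : ℝ) ^ 2 * M + U.card * (M : ℝ) ^ 2 +
            (U.card : ℝ) ^ (5 / 4 : ℝ) * (3 * T) ^ (1 / 2 : ℝ) * M)) := by rw [hHBb, e2]; ring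
      _ ≤ A * G₀ * (C₁ * (3 * T) ^ ε) * (4 * ((W.card : ℝ) ^ 4 * M + E₁ * (M : ℝ) ^ 2 +
            E₁ ^ (3 / 4 : ℝ) * W.card * (3 * T) ^ (1 / 2 : ℝ) * M)) :=
          mul_le_mul_of_nonneg_left halg (by positivity)
      _ = _ := by ring
  -- sum over the classes
  have hfour : ∀ n₁ ∈ S, ∀ n₂ ∈ S, ‖Rfun W ((n₁ : ℝ) / n₂)‖ ^ 4 ≤
      L * ∑ i ∈ cl, ‖∑ q ∈ clsPairs W i, ePair n₁ n₂ (q.1 - q.2)‖ ^ 2 := fun n₁ h₁ n₂ h₂ ↦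
    norm_Rfun_pow_four_le W (hS0 n₁ h₁) (hS0 n₂ h₂)
  have hsum : ∑ n₁ ∈ S, ∑ n₂ ∈ S, ‖Rfun W ((n₁ : ℝ) / n₂)‖ ^ 4 ≤
      L * (L * (4 * A * G₀ * C₁ * (3 * T) ^ ε * ((W.card : ℝ) ^ 4 * M + E₁ * (M : ℝ) ^ 2 +
        E₁ ^ (3 / 4 : ℝ) * W.card * (3 * T) ^ (1 / 2 : ℝ) * M))) := by
    calc ∑ n₁ ∈ S, ∑ n₂ ∈ S, ‖Rfun W ((n₁ : ℝ) / n₂)‖ ^ 4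
        ≤ ∑ n₁ ∈ S, ∑ n₂ ∈ S, L * ∑ i ∈ cl, ‖∑ q ∈ clsPairs W i, ePair n₁ n₂ (q.1 - q.2)‖ ^ 2 :=
          Finset.sum_le_sum fun n₁ h₁ ↦ Finset.sum_le_sum fun n₂ h₂ ↦ hfour n₁ h₁ n₂ h₂
      _ = L * ∑ i ∈ cl, ∑ n₁ ∈ S, ∑ n₂ ∈ S, ‖∑ q ∈ clsPairs W i, ePair n₁ n₂ (q.1 - q.2)‖ ^ 2 := by
          have hre : ∑ n₁ ∈ S, ∑ n₂ ∈ S, ∑ i ∈ cl, ‖∑ q ∈ clsPairs W i, ePair n₁ n₂ (q.1 - q.2)‖ ^ 2 =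
              ∑ i ∈ cl, ∑ n₁ ∈ S, ∑ n₂ ∈ S, ‖∑ q ∈ clsPairs W i, ePair n₁ n₂ (q.1 - q.2)‖ ^ 2 := by
            calc _ = ∑ n₁ ∈ S, ∑ i ∈ cl, ∑ n₂ ∈ S, ‖∑ q ∈ clsPairs W i, ePair n₁ n₂ (q.1 - q.2)‖ ^ 2 :=
                  Finset.sum_congr rfl fun _ _ ↦ Finset.sum_comm
              _ = _ := Finset.sum_comm
          rw [← hre]
          simp only [Finset.mul_sum]
      _ ≤ L * ∑ _i ∈ cl, (4 * A * G₀ * C₁ * (3 * T) ^ ε * ((W.card : ℝ) ^ 4 * M + E₁ * (M : ℝ) ^ 2 +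
            E₁ ^ (3 / 4 : ℝ) * W.card * (3 * T) ^ (1 / 2 : ℝ) * M)) := by
          refine mul_le_mul_of_nonneg_left (Finset.sum_le_sum fun i _ ↦ hclass i) (by positivity)
      _ = _ := by rw [Finset.sum_const, nsmul_eq_mul]
  refine hsum.trans ?_
  -- constants: `(3T)^ε = 3^ε T^ε`, `(3T)^{1/2} ≤ 2 T^{1/2}`
  have h3e : (3 * T) ^ ε = (3 : ℝ) ^ ε * T ^ ε := Real.mul_rpow (by norm_num) hT0.le
  have h3h : (3 * T) ^ (1 / 2 : ℝ) ≤ 2 * T ^ (1 / 2 : ℝ) := by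
    rw [Real.mul_rpow (by norm_num) hT0.le]
    refine mul_le_mul_of_nonneg_right ?_ (by positivity)
    have : (3 : ℝ) ^ (1 / 2 : ℝ) ≤ (4 : ℝ) ^ (1 / 2 : ℝ) := Real.rpow_le_rpow (by norm_num) (by norm_num) (by norm_num)
    have h4 : (4 : ℝ) ^ (1 / 2 : ℝ) = 2 := by
      rw [show (4 : ℝ) = 2 ^ 2 by norm_num, ← Real.rpow_natCast, ← Real.rpow_mul (by norm_num)]; norm_num
    linarith
  have hXle : (W.card : ℝ) ^ 4 * M + E₁ * (M : ℝ) ^ 2 + E₁ ^ (3 / 4 : ℝ) * W.card * (3 * T) ^ (1 / 2 : ℝ) * M ≤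
      2 * X := by
    rw [hX]
    have : E₁ ^ (3 / 4 : ℝ) * W.card * (3 * T) ^ (1 / 2 : ℝ) * M ≤
        2 * (E₁ ^ (3 / 4 : ℝ) * W.card * T ^ (1 / 2 : ℝ) * M) := by
      calc E₁ ^ (3 / 4 : ℝ) * W.card * (3 * T) ^ (1 / 2 : ℝ) * M
          ≤ E₁ ^ (3 / 4 : ℝ) * W.card * (2 * T ^ (1 / 2 : ℝ)) * M := by gcongr
        _ = _ := by ring
    have : 0 ≤ (W.card : ℝ) ^ 4 * M := by positivity
    have : 0 ≤ (M : ℝ) ^ 2 * E₁ := by positivity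
    nlinarith
  calc L * (L * (4 * A * G₀ * C₁ * (3 * T) ^ ε * ((W.card : ℝ) ^ 4 * M + E₁ * (M : ℝ) ^ 2 +
        E₁ ^ (3 / 4 : ℝ) * W.card * (3 * T) ^ (1 / 2 : ℝ) * M)))
      ≤ L * (L * (4 * A * G₀ * C₁ * (3 * T) ^ ε * (2 * X))) := by gcongr
    _ = 4 * A * G₀ * C₁ * (3 : ℝ) ^ ε * 2 * T ^ ε * L ^ 2 * X := by rw [h3e]; ring

end bump

/-! ## §5. Heath-Brown's theorem from the tree, the number of classes, and the unconditional forms -/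

/-- **Heath-Brown's theorem in the `hHB` format, from the tree's `HeathBrownDZS.heathBrown_differenceSet`**
(`DoubleZetaSumsHeathBrown.lean`, Guth–Maynard's Theorem 1.6): the range `(N, 2N]` is enlarged to
`[N, 2N]` (`|x + a_N N^{iθ}|² ≤ 2|x|² + 2`, `|𝒯|² ≤ |𝒯|²N T^ε`), and `T ≥ T₀(ε)` is relaxed to `T ≥ 1`
by the trivial bound `|𝒯|²(N+1)² ≤ 4(T₀+1)|𝒯|N²` for `T < T₀`.
[cite: GuthMaynard2026, Theorem 1.6] -/
theorem hHB_of_heathBrown_differenceSet (ε : ℝ) (hε : 0 < ε) :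
    ∃ C : ℝ, 0 ≤ C ∧ ∀ (N : ℕ) (T t₀ : ℝ) (a : ℕ → ℂ) (𝒯 : Finset ℝ),
      1 ≤ N → 1 ≤ T → (∀ n, ‖a n‖ ≤ 1) → (∀ t ∈ 𝒯, t₀ ≤ t ∧ t ≤ t₀ + T) →
      (∀ t ∈ 𝒯, ∀ t' ∈ 𝒯, t ≠ t' → 1 ≤ |t - t'|) →
      ∑ t₁ ∈ 𝒯, ∑ t₂ ∈ 𝒯, ‖∑ n ∈ Finset.Icc N (2 * N), a n * (n : ℂ) ^ ((((t₁ - t₂ : ℝ)) : ℂ) * I)‖ ^ 2 ≤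
        C * T ^ ε * ((𝒯.card : ℝ) ^ 2 * N + 𝒯.card * (N : ℝ) ^ 2 +
          (𝒯.card : ℝ) ^ (5 / 4 : ℝ) * T ^ (1 / 2 : ℝ) * N) := by
  obtain ⟨T₀, hT₀⟩ := HeathBrownDZS.heathBrown_differenceSet hε
  set T₁ : ℝ := max T₀ 1 with hT₁
  have hT₁1 : 1 ≤ T₁ := le_max_right _ _
  refine ⟨max 6 (4 * (T₁ + 1)), by positivity, fun N T t₀ a 𝒯 hN hT ha h𝒯 hsep ↦ ?_⟩
  have hN1 : (1 : ℝ) ≤ N := by exact_mod_cast hN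
  have hT0 : 0 < T := by linarith
  have hTε : 1 ≤ T ^ ε := Real.one_le_rpow hT hε.le
  set R : ℝ := (𝒯.card : ℝ) with hR
  have hR0 : 0 ≤ R := by positivity
  set X : ℝ := R ^ 2 * N + R * (N : ℝ) ^ 2 + R ^ (5 / 4 : ℝ) * T ^ (1 / 2 : ℝ) * N with hX
  have hX0 : 0 ≤ X := by positivity
  -- the `Icc`-sum is the `Ioc`-sum plus the term `n = N`
  have hsplit : ∀ θ : ℝ, ∑ n ∈ Finset.Icc N (2 * N), a n * (n : ℂ) ^ ((θ : ℂ) * I) =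
      a N * (N : ℂ) ^ ((θ : ℂ) * I) + ∑ n ∈ Finset.Ioc N (2 * N), a n * (n : ℂ) ^ ((θ : ℂ) * I) := by
    intro θ
    have : Finset.Icc N (2 * N) = insert N (Finset.Ioc N (2 * N)) := by
      ext n; simp only [Finset.mem_Icc, Finset.mem_insert, Finset.mem_Ioc]; omega
    rw [this, Finset.sum_insert (by simp)]
  have hterm : ∀ θ : ℝ, ‖a N * (N : ℂ) ^ ((θ : ℂ) * I)‖ ≤ 1 := by
    intro θ
    rw [norm_mul, Complex.norm_natCast_cpow_of_pos (by omega)]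
    simpa using ha N
  by_cases hTT : T₁ ≤ T
  · -- Heath-Brown applies
    have hHB' := hT₀ T (le_trans (le_max_left _ _) hTT) 𝒯 t₀ h𝒯 hsep N hN a ha
    have hle : ∑ t₁ ∈ 𝒯, ∑ t₂ ∈ 𝒯,
        ‖∑ n ∈ Finset.Icc N (2 * N), a n * (n : ℂ) ^ ((((t₁ - t₂ : ℝ)) : ℂ) * I)‖ ^ 2 ≤
        ∑ t₁ ∈ 𝒯, ∑ t₂ ∈ 𝒯,
          (2 * ‖∑ n ∈ Finset.Ioc N (2 * N), a n * (n : ℂ) ^ ((((t₁ - t₂ : ℝ)) : ℂ) * I)‖ ^ 2 + 2) := by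
      refine Finset.sum_le_sum fun t₁ _ ↦ Finset.sum_le_sum fun t₂ _ ↦ ?_
      rw [hsplit]
      have h1 := norm_add_le (a N * (N : ℂ) ^ ((((t₁ - t₂ : ℝ)) : ℂ) * I))
        (∑ n ∈ Finset.Ioc N (2 * N), a n * (n : ℂ) ^ ((((t₁ - t₂ : ℝ)) : ℂ) * I))
      have h2 := hterm (t₁ - t₂)
      have h3 : 0 ≤ ‖∑ n ∈ Finset.Ioc N (2 * N), a n * (n : ℂ) ^ ((((t₁ - t₂ : ℝ)) : ℂ) * I)‖ :=
        norm_nonneg _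
      have h4 := pow_le_pow_left₀ (norm_nonneg _) h1 2
      nlinarith [norm_nonneg (a N * (N : ℂ) ^ ((((t₁ - t₂ : ℝ)) : ℂ) * I)),
        sq_nonneg (‖a N * (N : ℂ) ^ ((((t₁ - t₂ : ℝ)) : ℂ) * I)‖ -
          ‖∑ n ∈ Finset.Ioc N (2 * N), a n * (n : ℂ) ^ ((((t₁ - t₂ : ℝ)) : ℂ) * I)‖)]
    refine hle.trans ?_
    rw [Finset.sum_congr rfl fun t₁ _ ↦ Finset.sum_add_distrib, Finset.sum_add_distrib]
    simp only [Finset.sum_const, nsmul_eq_mul, ← Finset.mul_sum]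
    have hcard : (𝒯.card : ℝ) * ((𝒯.card : ℝ) * 2) ≤ 2 * T ^ ε * X := by
      have : R ^ 2 ≤ X := by
        rw [hX]
        have : R ^ 2 ≤ R ^ 2 * N := by nlinarith
        have : 0 ≤ R * (N : ℝ) ^ 2 := by positivity
        have : 0 ≤ R ^ (5 / 4 : ℝ) * T ^ (1 / 2 : ℝ) * N := by positivity
        linarith
      rw [hR] at this
      nlinarith
    have hmain : 2 * ∑ t₁ ∈ 𝒯, ∑ t₂ ∈ 𝒯,
        ‖∑ n ∈ Finset.Ioc N (2 * N), a n * (n : ℂ) ^ ((((t₁ - t₂ : ℝ)) : ℂ) * I)‖ ^ 2 ≤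
        2 * (2 * T ^ ε * X) := by
      have := hHB'
      rw [← hR] at this
      have e : (R ^ 2 * N + R * N ^ 2 + R ^ (5 / 4 : ℝ) * T ^ (1 / 2 : ℝ) * N : ℝ) = X := by rw [hX]
      nlinarith
    calc 2 * ∑ t₁ ∈ 𝒯, ∑ t₂ ∈ 𝒯,
          ‖∑ n ∈ Finset.Ioc N (2 * N), a n * (n : ℂ) ^ ((((t₁ - t₂ : ℝ)) : ℂ) * I)‖ ^ 2 +
          (𝒯.card : ℝ) * ((𝒯.card : ℝ) * 2) ≤ 2 * (2 * T ^ ε * X) + 2 * T ^ ε * X := add_le_add hmain hcard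
      _ = 6 * T ^ ε * X := by ring
      _ ≤ max 6 (4 * (T₁ + 1)) * T ^ ε * X := by gcongr; exact le_max_left _ _
  · -- trivial bound for `T < T₁`
    push Not at hTT
    have hcardT : R ≤ T + 1 := by
      have := SeparatedSums.card_le_of_sep (δ := 1) (L := T) (a := t₀) one_pos hT0.le 𝒯 h𝒯 hsep
      rw [div_one] at this; exact this
    have hRT : R ≤ T₁ + 1 := by linarith
    have hD : ∀ t₁ t₂ : ℝ, ‖∑ n ∈ Finset.Icc N (2 * N), a n * (n : ℂ) ^ ((((t₁ - t₂ : ℝ)) : ℂ) * I)‖ ≤ 2 * N := by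
      intro t₁ t₂
      refine (norm_sum_le _ _).trans ?_
      have : ∀ n ∈ Finset.Icc N (2 * N), ‖a n * (n : ℂ) ^ ((((t₁ - t₂ : ℝ)) : ℂ) * I)‖ ≤ 1 := by
        intro n hn
        rw [Finset.mem_Icc] at hn
        rw [norm_mul, Complex.norm_natCast_cpow_of_pos (by omega)]
        simpa using ha n
      refine (Finset.sum_le_sum this).trans ?_
      rw [Finset.sum_const, Nat.card_Icc, nsmul_eq_mul, mul_one]
      have : (2 * N + 1 - N : ℕ) = N + 1 := by omega
      rw [this]; push_cast; linarith
    calc ∑ t₁ ∈ 𝒯, ∑ t₂ ∈ 𝒯, ‖∑ n ∈ Finset.Icc N (2 * N), a n * (n : ℂ) ^ ((((t₁ - t₂ : ℝ)) : ℂ) * I)‖ ^ 2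
        ≤ ∑ t₁ ∈ 𝒯, ∑ t₂ ∈ 𝒯, (2 * (N : ℝ)) ^ 2 :=
          Finset.sum_le_sum fun t₁ _ ↦ Finset.sum_le_sum fun t₂ _ ↦
            pow_le_pow_left₀ (norm_nonneg _) (hD t₁ t₂) 2
      _ = R * R * (4 * (N : ℝ) ^ 2) := by
          rw [Finset.sum_const, Finset.sum_const, nsmul_eq_mul, nsmul_eq_mul, hR]; ring
      _ ≤ (T₁ + 1) * R * (4 * (N : ℝ) ^ 2) := by gcongr
      _ = 4 * (T₁ + 1) * (R * (N : ℝ) ^ 2) := by ring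
      _ ≤ max 6 (4 * (T₁ + 1)) * T ^ ε * X := by
          have h1 : R * (N : ℝ) ^ 2 ≤ X := by
            rw [hX]
            have : 0 ≤ R ^ 2 * (N : ℝ) := by positivity
            have : 0 ≤ R ^ (5 / 4 : ℝ) * T ^ (1 / 2 : ℝ) * N := by positivity
            linarith
          have h2 : R * (N : ℝ) ^ 2 ≤ T ^ ε * X := by
            calc R * (N : ℝ) ^ 2 ≤ X := h1
              _ = 1 * X := (one_mul X).symm
              _ ≤ T ^ ε * X := mul_le_mul_of_nonneg_right hTε hX0
          calc 4 * (T₁ + 1) * (R * (N : ℝ) ^ 2) ≤ 4 * (T₁ + 1) * (T ^ ε * X) :=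
                mul_le_mul_of_nonneg_left h2 (by positivity)
            _ = 4 * (T₁ + 1) * T ^ ε * X := by ring
            _ ≤ max 6 (4 * (T₁ + 1)) * T ^ ε * X := by gcongr; exact le_max_right _ _

/-- **The number of dyadic classes**: `#{classes} ≤ log₂(|W|²) + 1` (each class index is
`⌊log₂ c(u)⌋` with `c(u) ≤ |W|²`). [cite: GuthMaynard2026, proof of Lemma 11.6] -/
theorem card_classes_le (W : Finset ℝ) :
    ((W ×ˢ W).image (cls W)).card ≤ Nat.log 2 (W.card ^ 2) + 1 := by
  classical
  have hsub : (W ×ˢ W).image (cls W) ⊆ Finset.range (Nat.log 2 (W.card ^ 2) + 1) := by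
    intro i hi
    rw [Finset.mem_image] at hi
    obtain ⟨q, _, rfl⟩ := hi
    rw [Finset.mem_range, Nat.lt_succ_iff, cls]
    refine Nat.log_mono_right ?_
    calc cnt W (uu q) ≤ (W ×ˢ W).card := Finset.card_filter_le _ _
      _ = W.card ^ 2 := by rw [Finset.card_product]; ring
  exact (Finset.card_le_card hsub).trans (by rw [Finset.card_range])

/-- `(log₂(|W|²) + 1)² ≪_δ T^δ` for `1`-separated `W` in an interval of length `T ≥ 1` (`|W| ≤ T + 1`).
[folklore] -/
theorem classes_sq_le_rpow {δ : ℝ} (hδ : 0 < δ) : ∃ C : ℝ, 0 ≤ C ∧ ∀ (T t₀ : ℝ) (W : Finset ℝ), 1 ≤ T →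
    (∀ t ∈ W, t₀ ≤ t ∧ t ≤ t₀ + T) → (∀ t ∈ W, ∀ t' ∈ W, t ≠ t' → 1 ≤ |t - t'|) →
    ((((W ×ˢ W).image (cls W)).card : ℝ)) ^ 2 ≤ C * T ^ δ := by
  set δ' : ℝ := min δ 1 with hδ'
  have hδ'0 : 0 < δ' := lt_min hδ one_pos
  have hδ'1 : δ' ≤ 1 := min_le_right _ _
  have hδ'δ : δ' ≤ δ := min_le_left _ _
  have hlog2 : 0 < Real.log 2 := Real.log_pos one_lt_two
  set K : ℝ := 16 / (δ' * Real.log 2) + 1 with hK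
  have hK1 : 1 ≤ K := le_add_of_nonneg_left (by positivity)
  refine ⟨K ^ 2, by positivity, fun T t₀ W hT hW hsep ↦ ?_⟩
  have hT0 : 0 < T := by linarith
  have hL := card_classes_le W
  set m : ℕ := W.card ^ 2 with hm
  -- `Nat.log 2 m ≤ (4/(δ' log 2)) m^{δ'/4}`
  have h1 : (Nat.log 2 m : ℝ) ≤ 4 / (δ' * Real.log 2) * (m : ℝ) ^ (δ' / 4) := by
    rcases Nat.eq_zero_or_pos m with h0 | hpos
    · rw [h0]; simp; positivity
    · have hp := Nat.pow_log_le_self 2 (Nat.pos_iff_ne_zero.mp hpos)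
      have hp' : (2 : ℝ) ^ (Nat.log 2 m) ≤ m := by exact_mod_cast hp
      have hl : (Nat.log 2 m : ℝ) * Real.log 2 ≤ Real.log m := by
        have := Real.log_le_log (by positivity) hp'
        rwa [Real.log_pow] at this
      have hl2 : Real.log m ≤ (m : ℝ) ^ (δ' / 4) / (δ' / 4) :=
        Real.log_le_rpow_div (by positivity) (by positivity)
      rw [div_mul_eq_mul_div, le_div_iff₀ (by positivity)]
      calc (Nat.log 2 m : ℝ) * (δ' * Real.log 2) = δ' * ((Nat.log 2 m : ℝ) * Real.log 2) := by ring
        _ ≤ δ' * ((m : ℝ) ^ (δ' / 4) / (δ' / 4)) := by gcongr; exact hl.trans hl2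
        _ = 4 * (m : ℝ) ^ (δ' / 4) := by field_simp
  -- `m = |W|² ≤ 4T²`, so `m^{δ'/4} ≤ 4 T^{δ'/2}`
  have hcard : (W.card : ℝ) ≤ 2 * T := by
    have := SeparatedSums.card_le_of_sep (δ := 1) (L := T) (a := t₀) one_pos hT0.le W hW hsep
    rw [div_one] at this; linarith
  have hm_le : (m : ℝ) ≤ 4 * T ^ 2 := by
    rw [hm]; push_cast; nlinarith [Nat.cast_nonneg (α := ℝ) W.card]
  have h44 : (4 : ℝ) ^ (δ' / 4) ≤ 4 := by
    calc (4 : ℝ) ^ (δ' / 4) ≤ (4 : ℝ) ^ (1 : ℝ) :=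
          Real.rpow_le_rpow_of_exponent_le (by norm_num) (by linarith)
      _ = 4 := Real.rpow_one 4
  have h2 : (m : ℝ) ^ (δ' / 4) ≤ 4 * T ^ (δ' / 2) := by
    have e : (4 * T ^ 2) ^ (δ' / 4) = (4 : ℝ) ^ (δ' / 4) * T ^ (δ' / 2) := by
      rw [Real.mul_rpow (by norm_num) (by positivity), ← Real.rpow_natCast T 2,
        ← Real.rpow_mul hT0.le]
      congr 1; push_cast; ring
    calc (m : ℝ) ^ (δ' / 4) ≤ (4 * T ^ 2) ^ (δ' / 4) := Real.rpow_le_rpow (by positivity) hm_le (by positivity)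
      _ = (4 : ℝ) ^ (δ' / 4) * T ^ (δ' / 2) := e
      _ ≤ 4 * T ^ (δ' / 2) := mul_le_mul_of_nonneg_right h44 (by positivity)
  -- assemble: `L ≤ K T^{δ'/2}`
  have hTp : 1 ≤ T ^ (δ' / 2) := Real.one_le_rpow hT (by positivity)
  have hLle : ((((W ×ˢ W).image (cls W)).card : ℝ)) ≤ K * T ^ (δ' / 2) := by
    have hL' : ((((W ×ˢ W).image (cls W)).card : ℝ)) ≤ (Nat.log 2 m : ℝ) + 1 := by
      rw [hm]; exact_mod_cast hL
    calc _ ≤ (Nat.log 2 m : ℝ) + 1 := hL'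
      _ ≤ 4 / (δ' * Real.log 2) * (4 * T ^ (δ' / 2)) + 1 * T ^ (δ' / 2) := by
          gcongr
          · exact h1.trans (mul_le_mul_of_nonneg_left h2 (by positivity))
          · linarith
      _ = K * T ^ (δ' / 2) := by rw [hK]; ring
  calc ((((W ×ˢ W).image (cls W)).card : ℝ)) ^ 2 ≤ (K * T ^ (δ' / 2)) ^ 2 :=
        pow_le_pow_left₀ (by positivity) hLle 2
    _ = K ^ 2 * T ^ δ' := by
        rw [mul_pow, ← Real.rpow_natCast (T ^ (δ' / 2)) 2, ← Real.rpow_mul hT0.le]; norm_num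
    _ ≤ K ^ 2 * T ^ δ := by gcongr

/-- **Guth–Maynard Lemma 11.5 (Discrete second moment), unconditionally** (Heath-Brown's theorem from
the tree): for every `ε > 0` there is `C` with
`∑_{n₁,n₂∈[M,2M]} |R(n₁/n₂)|² ≤ C T^ε (|W|²M + |W|M² + |W|^{5/4}T^{1/2}M)` for all `M, T ≥ 1` and finite
`1`-separated `W ⊂ [t₀, t₀+T]`. [cite: GuthMaynard2026, Lemma 11.5] -/
theorem discrete_second_moment {ε : ℝ} (hε : 0 < ε) :
    ∃ C : ℝ, 0 ≤ C ∧ ∀ (M : ℕ) (T t₀ : ℝ) (W : Finset ℝ), 1 ≤ M → 1 ≤ T →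
      (∀ t ∈ W, t₀ ≤ t ∧ t ≤ t₀ + T) → (∀ t ∈ W, ∀ t' ∈ W, t ≠ t' → 1 ≤ |t - t'|) →
      ∑ n₁ ∈ Finset.Icc M (2 * M), ∑ n₂ ∈ Finset.Icc M (2 * M), ‖Rfun W ((n₁ : ℝ) / n₂)‖ ^ 2 ≤
        C * T ^ ε * ((W.card : ℝ) ^ 2 * M + W.card * (M : ℝ) ^ 2 +
          (W.card : ℝ) ^ (5 / 4 : ℝ) * T ^ (1 / 2 : ℝ) * M) :=
  discrete_second_moment_of_HB hHB_of_heathBrown_differenceSet hε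

set_option maxHeartbeats 800000 in
/-- **Guth–Maynard Lemma 11.6 (Discrete fourth moment), unconditionally and in the printed form**
(Heath-Brown's theorem from the tree; the factor `L²`, `L ≤ log₂|W|² + 1` classes, absorbed into `T^ε`):
for every `ε > 0` there is `C` with
`∑_{n₁,n₂∈[M,2M]} |R(n₁/n₂)|⁴ ≤ C T^ε (|W|⁴M + M²E(W) + E(W)^{3/4}|W|T^{1/2}M)` for all `M, T ≥ 1` and
finite `1`-separated `W ⊂ [t₀, t₀+T]`, `E(W) = #{|t₁+t₂−t₃−t₄| ≤ 1}`. [cite: GuthMaynard2026, Lemma 11.6] -/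
theorem discrete_fourth_moment {ε : ℝ} (hε : 0 < ε) :
    ∃ C : ℝ, 0 ≤ C ∧ ∀ (M : ℕ) (T t₀ : ℝ) (W : Finset ℝ), 1 ≤ M → 1 ≤ T →
      (∀ t ∈ W, t₀ ≤ t ∧ t ≤ t₀ + T) → (∀ t ∈ W, ∀ t' ∈ W, t ≠ t' → 1 ≤ |t - t'|) →
      ∑ n₁ ∈ Finset.Icc M (2 * M), ∑ n₂ ∈ Finset.Icc M (2 * M), ‖Rfun W ((n₁ : ℝ) / n₂)‖ ^ 4 ≤
        C * T ^ ε * ((W.card : ℝ) ^ 4 * M + (M : ℝ) ^ 2 * ((((W ×ˢ W) ×ˢ (W ×ˢ W)).filter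
            (fun q : (ℝ × ℝ) × (ℝ × ℝ) ↦ |q.1.1 + q.1.2 - q.2.1 - q.2.2| ≤ 1)).card : ℝ) +
          (((((W ×ˢ W) ×ˢ (W ×ˢ W)).filter
            (fun q : (ℝ × ℝ) × (ℝ × ℝ) ↦ |q.1.1 + q.1.2 - q.2.1 - q.2.2| ≤ 1)).card : ℝ)) ^
              (3 / 4 : ℝ) * W.card * T ^ (1 / 2 : ℝ) * M) := by
  have hε2 : 0 < ε / 2 := by positivity
  obtain ⟨C₁, hC₁0, hC₁⟩ := discrete_fourth_moment_of_HB hHB_of_heathBrown_differenceSet hε2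
  obtain ⟨C₂, hC₂0, hC₂⟩ := classes_sq_le_rpow hε2
  refine ⟨C₁ * C₂, by positivity, fun M T t₀ W hM hT hW hsep ↦ ?_⟩
  have hT0 : 0 < T := by linarith
  have h1 := hC₁ M T t₀ W hM hT hW hsep
  have h2 := hC₂ T t₀ W hT hW hsep
  refine h1.trans ?_
  set X : ℝ := (W.card : ℝ) ^ 4 * M + (M : ℝ) ^ 2 * ((((W ×ˢ W) ×ˢ (W ×ˢ W)).filter
      (fun q : (ℝ × ℝ) × (ℝ × ℝ) ↦ |q.1.1 + q.1.2 - q.2.1 - q.2.2| ≤ 1)).card : ℝ) +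
    (((((W ×ˢ W) ×ˢ (W ×ˢ W)).filter
      (fun q : (ℝ × ℝ) × (ℝ × ℝ) ↦ |q.1.1 + q.1.2 - q.2.1 - q.2.2| ≤ 1)).card : ℝ)) ^
        (3 / 4 : ℝ) * W.card * T ^ (1 / 2 : ℝ) * M with hX
  have hX0 : 0 ≤ X := by positivity
  have hTT : T ^ (ε / 2) * T ^ (ε / 2) = T ^ ε := by rw [← Real.rpow_add hT0]; ring_nf
  calc C₁ * T ^ (ε / 2) * ((((W ×ˢ W).image (cls W)).card : ℝ)) ^ 2 * X
      ≤ C₁ * T ^ (ε / 2) * (C₂ * T ^ (ε / 2)) * X := by gcongr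
    _ = C₁ * C₂ * (T ^ (ε / 2) * T ^ (ε / 2)) * X := by ring
    _ = C₁ * C₂ * T ^ ε * X := by rw [hTT]

end GuthMaynardDiscreteMoments

end Literature.NumberTheory.LFunctions

end
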